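import Literature.Probability.LatticeModels.DobrushinComparisonMetric
import Mathlib.Analysis.SpecialFunctions.Exp
import HarnessLib

/-!
# The Dobrushin–Shlosman window comparison in the Vasserstein form, abstract part

The Dobrushin–Shlosman finite-size ("constructive") criterion replaces the one-SITE resampling of Dobrushin's
uniqueness technique by the resampling of a whole WINDOW of cells at once, and Dobrushin's row-sum condition by
a condition on the boundary influence received by a cell, AVERAGED over the positions of the window around it
(Dobrushin–Shlosman 1985, condition `C_V`). This file is the window analogue of the abstract dusting layer
`DobrushinComparisonMetric.lean` (`DobrushinMetric.DustingData`, Föllmer 1988, Ch. I §2 in the Vasserstein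
form), written as theorems over explicit data (no bundled structure): cells `ι` (a finite type),
configurations `Ω`, admissible observables `Adm`, cell-Lipschitz vectors `Lip F δ` (`|F σ - F τ| ≤ δ x · w x σ τ` off one cell, abstracted), WINDOW
averaging operators `T c` (resampling all cells of the window `win c` at once), influence coefficients
`k c y x ≥ 0` (boundary cell `y`, interior cell `x ∈ win c`), a weight bound `R`, two functionals `E₁, E₂`
and the usable centres `U`. No measure theory and no torus geometry appear here.

## Contents and the contraction mechanism

* **Dusting** (hypothesis `hdust`, discharged for a specification in `DobrushinShlosmanWindowDusting.lean`
  from a one-boundary-cell Kantorovich contraction hypothesis): a Lipschitz vector `δ` of `F` becomes, for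
  `T c F`, the vector `δ' y = 0` on `win c` and `δ' y = δ y + Σ_{x ∈ win c} k c y x δ x` off `win c`.
* **Estimates**: vectors `a` with `|E₁ F - E₂ F| ≤ Σ_x a x δ x` for all admissible `F` and Lipschitz vectors
  `δ` (sums over the finite cell type). For monotone-normalised functionals the constant vector `R` is an
  estimate (`const_estimate`); for functionals invariant under the usable window operators the single-window
  update (`a` off `win c`, `x ↦ Σ_y k c y x a y` on `win c`) of an estimate is an estimate (`upd_estimate`);
  CONVEX COMBINATIONS of estimates are estimates, whence the averaged step (weight `ε/|ι|` on every usable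
  update) is (`step_estimate`, `iterate_estimate`).
* **Contraction** (companion file `DobrushinShlosmanContraction.lean`). The Dobrushin–Shlosman hypothesis is
  the RECEIVED sum `Σ_{c ∋ x} Σ_y k c y x ≤ γ₀ |{c ∋ x}|`, which controls only the average over ALL centres around `x`; a
  single update may multiply a coordinate by `γ₀ |{c ∋ x}|`, and around cells near the tilt region (where
  only some centres are usable) the averaged step genuinely INCREASES the estimate. Honest resolution: the
  time-dependent three-zone invariant `(step^m R) x ≤ R (G^m θ^{ℓ x} + β^m)` (growth budget
  `G = 1 + ε(2γ₀N⋆+1)/|ι|` on the zone `ℓ = 0`, decay `β = 1 - ε(1-γ₀)/|ι|` of the not-yet-resampled mass,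
  standing profile `θ ≥ γ₀` in the bulk); after `|ι| L₀` steps with `ε = (1-γ₀)/(2(2γ₀N⋆+1))`,
  `θ = e^{γ₀-1}`, both terms are `≤ e^{-κ₁ L₀}`, `κ₁ = (1-γ₀)²/(2(2γ₀N⋆+1))`, free of `|ι|`.

References: Dobrushin–Shlosman 1985 (constructive criterion `C_V`); Föllmer 1988 Ch. I §2 (Lemma (2.5),
Comparison Theorem (2.8), Remark (2.17)); the tree files `DobrushinComparison(Metric).lean`.
-/

open Finset

noncomputable section

namespace Literature.Probability.LatticeModels.DobrushinShlosman

variable {ι Ω : Type*} [Fintype ι] [DecidableEq ι]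
variable {R : ℝ} {Adm : (Ω → ℝ) → Prop} {Lip : (Ω → ℝ) → (ι → ℝ) → Prop} {T : ι → (Ω → ℝ) → (Ω → ℝ)}
  {win : ι → Finset ι} {k : ι → ι → ι → ℝ} {U : Finset ι} {E₁ E₂ : (Ω → ℝ) → ℝ}

/-! ### The constant estimate -/

omit [DecidableEq ι] in
/-- **The constant vector `R` is an estimate** for two monotone-normalised functionals
(`inf F ≤ E F ≤ sup F` on admissible `F`) when Lipschitz vectors come with the interpolation bound
`|F σ - F τ| ≤ R Σ_x δ x`: `|E₁ F - E₂ F| ≤ sup F - inf F ≤ Σ_x R δ x` (Föllmer 1988 Ch. I (2.22)).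
[cite: Follmer1988, Ch. I (2.22)] -/
theorem const_estimate
    (hosc : ∀ ⦃F : Ω → ℝ⦄ ⦃δ : ι → ℝ⦄, Adm F → Lip F δ → ∀ σ τ, |F σ - F τ| ≤ R * ∑ x, δ x)
    (h₁le : ∀ ⦃F : Ω → ℝ⦄ ⦃M : ℝ⦄, Adm F → (∀ σ, F σ ≤ M) → E₁ F ≤ M)
    (h₁ge : ∀ ⦃F : Ω → ℝ⦄ ⦃M : ℝ⦄, Adm F → (∀ σ, M ≤ F σ) → M ≤ E₁ F)
    (h₂le : ∀ ⦃F : Ω → ℝ⦄ ⦃M : ℝ⦄, Adm F → (∀ σ, F σ ≤ M) → E₂ F ≤ M)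
    (h₂ge : ∀ ⦃F : Ω → ℝ⦄ ⦃M : ℝ⦄, Adm F → (∀ σ, M ≤ F σ) → M ≤ E₂ F)
    ⦃F : Ω → ℝ⦄ ⦃δ : ι → ℝ⦄ (hF : Adm F) (hδ : Lip F δ) :
    |E₁ F - E₂ F| ≤ ∑ x, (fun _ : ι => R) x * δ x := by
  -- adapted from `DobrushinMetric.DustingData.isEstimate_const`
  have hB : ∀ σ τ, F σ ≤ F τ + R * ∑ x, δ x := fun σ τ => by
    have h := hosc hF hδ σ τ
    linarith [(abs_le.1 h).2]
  have h12 : E₁ F ≤ E₂ F + R * ∑ x, δ x := h₁le hF fun σ => by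
    have : F σ - R * ∑ x, δ x ≤ E₂ F := h₂ge hF fun τ => by linarith [hB σ τ]
    linarith
  have h21 : E₂ F ≤ E₁ F + R * ∑ x, δ x := h₂le hF fun σ => by
    have : F σ - R * ∑ x, δ x ≤ E₁ F := h₁ge hF fun τ => by linarith [hB σ τ]
    linarith
  rw [← Finset.mul_sum, abs_le]
  constructor <;> linarith

/-! ### The single-window update -/

/-- **Window dusting step** (Föllmer 1988 Ch. I, proof of Lemma (2.5), one WINDOW instead of one site;
Dobrushin–Shlosman 1985): for two functionals invariant under the usable window operators and a nonnegative
estimate `a`, the single-window update at a usable centre `c` — `a` off `win c`, `x ↦ Σ_y k c y x a y` on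
`win c` — is an estimate: apply the estimate to `T c F` (same values of the functionals) and the window
dusting hypothesis `hdust` (`T c F` has Lipschitz vector `0` on `win c` and `δ y + Σ_{x ∈ win c} k c y x δ x`
off it). [cite: Follmer1988, Ch. I Lemma (2.5)] -/
theorem upd_estimate (hlip0 : ∀ ⦃F : Ω → ℝ⦄ ⦃δ : ι → ℝ⦄, Lip F δ → ∀ x, 0 ≤ δ x)
    (hk : ∀ c y x, 0 ≤ k c y x) (hT : ∀ ⦃F : Ω → ℝ⦄ (c : ι), Adm F → Adm (T c F))
    (hdust : ∀ ⦃F : Ω → ℝ⦄ ⦃δ : ι → ℝ⦄ (c : ι), Adm F → Lip F δ →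
      Lip (T c F) fun y => if y ∈ win c then 0 else δ y + ∑ x ∈ win c, k c y x * δ x)
    (h₁T : ∀ ⦃F : Ω → ℝ⦄ (c : ι), c ∈ U → Adm F → E₁ (T c F) = E₁ F)
    (h₂T : ∀ ⦃F : Ω → ℝ⦄ (c : ι), c ∈ U → Adm F → E₂ (T c F) = E₂ F)
    {a : ι → ℝ} (ha : ∀ ⦃F : Ω → ℝ⦄ ⦃δ : ι → ℝ⦄, Adm F → Lip F δ → |E₁ F - E₂ F| ≤ ∑ x, a x * δ x)
    (ha0 : ∀ x, 0 ≤ a x) {c : ι} (hc : c ∈ U) ⦃F : Ω → ℝ⦄ ⦃δ : ι → ℝ⦄ (hF : Adm F) (hδ : Lip F δ) :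
    |E₁ F - E₂ F| ≤ ∑ x, (if x ∈ win c then ∑ y, k c y x * a y else a x) * δ x := by
  have key := ha (hT c hF) (hdust c hF hδ)
  rw [h₁T c hc hF, h₂T c hc hF] at key
  refine key.trans ?_
  have hδ0 := hlip0 hδ
  -- bookkeeping: `Σ_y a y δ' y ≤ Σ_{y ∉ win} a y δ y + Σ_{x ∈ win} (Σ_y k c y x a y) δ x`
  have h1 : ∑ y, a y * (if y ∈ win c then 0 else δ y + ∑ x ∈ win c, k c y x * δ x) =
      ∑ y, (if y ∈ win c then 0 else a y * δ y) +
        ∑ y, (if y ∈ win c then 0 else ∑ x ∈ win c, a y * k c y x * δ x) := by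
    rw [← Finset.sum_add_distrib]
    refine Finset.sum_congr rfl fun y _ => ?_
    split_ifs
    · simp
    · rw [mul_add, Finset.mul_sum]
      exact congrArg _ (Finset.sum_congr rfl fun x _ => by ring)
  have h2 : ∑ y, (if y ∈ win c then 0 else ∑ x ∈ win c, a y * k c y x * δ x) ≤
      ∑ y, ∑ x ∈ win c, a y * k c y x * δ x := by
    refine Finset.sum_le_sum fun y _ => ?_
    split_ifs
    · exact Finset.sum_nonneg fun x _ => mul_nonneg (mul_nonneg (ha0 y) (hk c y x)) (hδ0 x)
    · exact le_rfl
  have h3 : ∑ x, (if x ∈ win c then ∑ y, k c y x * a y else a x) * δ x =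
      ∑ x, (if x ∈ win c then 0 else a x * δ x) + ∑ x ∈ win c, (∑ y, k c y x * a y) * δ x := by
    rw [← Finset.sum_add_sum_compl (win c)
        (fun x => (if x ∈ win c then ∑ y, k c y x * a y else a x) * δ x),
      ← Finset.sum_add_sum_compl (win c) (fun x => if x ∈ win c then 0 else a x * δ x)]
    have e1 : ∑ x ∈ win c, (if x ∈ win c then ∑ y, k c y x * a y else a x) * δ x =
        ∑ x ∈ win c, (∑ y, k c y x * a y) * δ x :=
      Finset.sum_congr rfl fun x hx => by rw [if_pos hx]
    have e2 : ∑ x ∈ (win c)ᶜ, (if x ∈ win c then ∑ y, k c y x * a y else a x) * δ x =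
        ∑ x ∈ (win c)ᶜ, a x * δ x :=
      Finset.sum_congr rfl fun x hx => by rw [if_neg (Finset.mem_compl.1 hx)]
    have e3 : ∑ x ∈ win c, (if x ∈ win c then 0 else a x * δ x) = 0 :=
      Finset.sum_eq_zero fun x hx => if_pos hx
    have e4 : ∑ x ∈ (win c)ᶜ, (if x ∈ win c then 0 else a x * δ x) = ∑ x ∈ (win c)ᶜ, a x * δ x :=
      Finset.sum_congr rfl fun x hx => if_neg (Finset.mem_compl.1 hx)
    rw [e1, e2, e3, e4]
    ring
  have h4 : ∑ y, ∑ x ∈ win c, a y * k c y x * δ x = ∑ x ∈ win c, (∑ y, k c y x * a y) * δ x := by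
    rw [Finset.sum_comm]
    refine Finset.sum_congr rfl fun x _ => ?_
    rw [Finset.sum_mul]
    exact Finset.sum_congr rfl fun y _ => by ring
  rw [h1, h3, ← h4]
  exact add_le_add le_rfl h2

/-- The single-window update of a nonnegative vector is nonnegative. [folklore] -/
theorem upd_nonneg (hk : ∀ c y x, 0 ≤ k c y x) {a : ι → ℝ} (ha : ∀ x, 0 ≤ a x) (c x : ι) :
    0 ≤ (if x ∈ win c then ∑ y, k c y x * a y else a x) := by
  split_ifs
  · exact Finset.sum_nonneg fun y _ => mul_nonneg (hk c y x) (ha y)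
  · exact ha x

/-! ### The averaged step -/

omit [DecidableEq ι] in
/-- The identity weight of the averaged step is nonnegative for `ε ≤ 1`. [folklore] -/
theorem step_weight_nonneg (U : Finset ι) {ε : ℝ} (hε1 : ε ≤ 1) :
    0 ≤ 1 - ε * U.card / Fintype.card ι := by
  rcases Nat.eq_zero_or_pos (Fintype.card ι) with h0 | hpos
  · simp [h0]
  · have hι : (0 : ℝ) < Fintype.card ι := by exact_mod_cast hpos
    have hU : (U.card : ℝ) ≤ Fintype.card ι := by exact_mod_cast Finset.card_le_univ U
    rw [sub_nonneg, div_le_one hι]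
    calc ε * U.card ≤ 1 * U.card := mul_le_mul_of_nonneg_right hε1 (Nat.cast_nonneg _)
      _ ≤ Fintype.card ι := by rw [one_mul]; exact hU

/-- **The averaged step** `step a x = (1 - ε |U| / |ι|) a x + (ε / |ι|) Σ_{c ∈ U} upd_c a x` (weight `ε/|ι|`
on the single-window update at every usable centre, the rest on the identity; Dobrushin–Shlosman's averaging
over window positions) preserves nonnegativity. [folklore] -/
theorem step_nonneg (hk : ∀ c y x, 0 ≤ k c y x) {ε : ℝ} (hε0 : 0 ≤ ε) (hε1 : ε ≤ 1)
    {step : (ι → ℝ) → ι → ℝ} (hstep : ∀ a x, step a x = (1 - ε * U.card / Fintype.card ι) * a x +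
      ε / Fintype.card ι * ∑ c ∈ U, (if x ∈ win c then ∑ y, k c y x * a y else a x))
    {a : ι → ℝ} (ha : ∀ x, 0 ≤ a x) (x : ι) : 0 ≤ step a x := by
  rw [hstep]
  exact add_nonneg (mul_nonneg (step_weight_nonneg U hε1) (ha x))
    (mul_nonneg (div_nonneg hε0 (Nat.cast_nonneg _))
      (Finset.sum_nonneg fun c _ => upd_nonneg hk ha c x))

/-- **Convex combinations of estimates are estimates**: for functionals invariant under the usable window
operators, the averaged step of a nonnegative estimate is an estimate. [cite: Follmer1988, Ch. I Lemma (2.5)] -/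
theorem step_estimate (hlip0 : ∀ ⦃F : Ω → ℝ⦄ ⦃δ : ι → ℝ⦄, Lip F δ → ∀ x, 0 ≤ δ x)
    (hk : ∀ c y x, 0 ≤ k c y x) (hT : ∀ ⦃F : Ω → ℝ⦄ (c : ι), Adm F → Adm (T c F))
    (hdust : ∀ ⦃F : Ω → ℝ⦄ ⦃δ : ι → ℝ⦄ (c : ι), Adm F → Lip F δ →
      Lip (T c F) fun y => if y ∈ win c then 0 else δ y + ∑ x ∈ win c, k c y x * δ x)
    (h₁T : ∀ ⦃F : Ω → ℝ⦄ (c : ι), c ∈ U → Adm F → E₁ (T c F) = E₁ F)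
    (h₂T : ∀ ⦃F : Ω → ℝ⦄ (c : ι), c ∈ U → Adm F → E₂ (T c F) = E₂ F)
    {ε : ℝ} (hε0 : 0 ≤ ε) (hε1 : ε ≤ 1) {step : (ι → ℝ) → ι → ℝ}
    (hstep : ∀ a x, step a x = (1 - ε * U.card / Fintype.card ι) * a x +
      ε / Fintype.card ι * ∑ c ∈ U, (if x ∈ win c then ∑ y, k c y x * a y else a x))
    {a : ι → ℝ} (ha : ∀ ⦃F : Ω → ℝ⦄ ⦃δ : ι → ℝ⦄, Adm F → Lip F δ → |E₁ F - E₂ F| ≤ ∑ x, a x * δ x)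
    (ha0 : ∀ x, 0 ≤ a x) ⦃F : Ω → ℝ⦄ ⦃δ : ι → ℝ⦄ (hF : Adm F) (hδ : Lip F δ) :
    |E₁ F - E₂ F| ≤ ∑ x, step a x * δ x := by
  have hw := step_weight_nonneg U hε1 (ι := ι)
  have hq : 0 ≤ ε / Fintype.card ι := div_nonneg hε0 (Nat.cast_nonneg _)
  have hA : (1 - ε * U.card / Fintype.card ι) * |E₁ F - E₂ F| ≤
      (1 - ε * U.card / Fintype.card ι) * ∑ x, a x * δ x :=
    mul_le_mul_of_nonneg_left (ha hF hδ) hw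
  have hB : ∀ c ∈ U, ε / Fintype.card ι * |E₁ F - E₂ F| ≤
      ε / Fintype.card ι * ∑ x, (if x ∈ win c then ∑ y, k c y x * a y else a x) * δ x := fun c hc =>
    mul_le_mul_of_nonneg_left (upd_estimate hlip0 hk hT hdust h₁T h₂T ha ha0 hc hF hδ) hq
  have hsum := Finset.sum_le_sum hB
  rw [Finset.sum_const, nsmul_eq_mul] at hsum
  have hsplit : |E₁ F - E₂ F| = (1 - ε * U.card / Fintype.card ι) * |E₁ F - E₂ F| +
      U.card * (ε / Fintype.card ι * |E₁ F - E₂ F|) := by ring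
  have hexp : ∑ x, step a x * δ x = (1 - ε * U.card / Fintype.card ι) * ∑ x, a x * δ x +
      ∑ c ∈ U, ε / Fintype.card ι * ∑ x, (if x ∈ win c then ∑ y, k c y x * a y else a x) * δ x := by
    calc ∑ x, step a x * δ x
        = ∑ x, ((1 - ε * U.card / Fintype.card ι) * (a x * δ x) +
            ε / Fintype.card ι * ∑ c ∈ U, (if x ∈ win c then ∑ y, k c y x * a y else a x) * δ x) :=
          Finset.sum_congr rfl fun x _ => by rw [hstep, ← Finset.sum_mul]; ring
      _ = ∑ x, (1 - ε * U.card / Fintype.card ι) * (a x * δ x) +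
            ∑ x, ε / Fintype.card ι * ∑ c ∈ U, (if x ∈ win c then ∑ y, k c y x * a y else a x) * δ x :=
          Finset.sum_add_distrib
      _ = (1 - ε * U.card / Fintype.card ι) * ∑ x, a x * δ x + ε / Fintype.card ι *
            ∑ x, ∑ c ∈ U, (if x ∈ win c then ∑ y, k c y x * a y else a x) * δ x := by
          rw [← Finset.mul_sum, ← Finset.mul_sum]
      _ = (1 - ε * U.card / Fintype.card ι) * ∑ x, a x * δ x + ε / Fintype.card ι *
            ∑ c ∈ U, ∑ x, (if x ∈ win c then ∑ y, k c y x * a y else a x) * δ x := by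
          rw [Finset.sum_comm]
      _ = _ := by rw [Finset.mul_sum U]
  rw [hexp, hsplit]
  exact add_le_add hA hsum

/-- All iterates of the averaged step started at a nonnegative constant vector are nonnegative. [folklore] -/
theorem iterate_step_nonneg (hk : ∀ c y x, 0 ≤ k c y x) {ε : ℝ} (hε0 : 0 ≤ ε) (hε1 : ε ≤ 1)
    {step : (ι → ℝ) → ι → ℝ} (hstep : ∀ a x, step a x = (1 - ε * U.card / Fintype.card ι) * a x +
      ε / Fintype.card ι * ∑ c ∈ U, (if x ∈ win c then ∑ y, k c y x * a y else a x))
    (hR : 0 ≤ R) (m : ℕ) (x : ι) : 0 ≤ step^[m] (fun _ => R) x := by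
  induction m generalizing x with
  | zero => exact hR
  | succ m ih => rw [Function.iterate_succ_apply']; exact step_nonneg hk hε0 hε1 hstep ih x

/-- **All iterates of the averaged step started at the constant vector `R` are estimates** (Föllmer 1988
Ch. I, "applying the lemma successively"), for monotone-normalised functionals invariant under the usable
window operators. [cite: Follmer1988, Ch. I Comparison Theorem (2.8)] -/
theorem iterate_estimate (hR : 0 ≤ R) (hlip0 : ∀ ⦃F : Ω → ℝ⦄ ⦃δ : ι → ℝ⦄, Lip F δ → ∀ x, 0 ≤ δ x)
    (hosc : ∀ ⦃F : Ω → ℝ⦄ ⦃δ : ι → ℝ⦄, Adm F → Lip F δ → ∀ σ τ, |F σ - F τ| ≤ R * ∑ x, δ x)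
    (hk : ∀ c y x, 0 ≤ k c y x) (hT : ∀ ⦃F : Ω → ℝ⦄ (c : ι), Adm F → Adm (T c F))
    (hdust : ∀ ⦃F : Ω → ℝ⦄ ⦃δ : ι → ℝ⦄ (c : ι), Adm F → Lip F δ →
      Lip (T c F) fun y => if y ∈ win c then 0 else δ y + ∑ x ∈ win c, k c y x * δ x)
    (h₁le : ∀ ⦃F : Ω → ℝ⦄ ⦃M : ℝ⦄, Adm F → (∀ σ, F σ ≤ M) → E₁ F ≤ M)
    (h₁ge : ∀ ⦃F : Ω → ℝ⦄ ⦃M : ℝ⦄, Adm F → (∀ σ, M ≤ F σ) → M ≤ E₁ F)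
    (h₁T : ∀ ⦃F : Ω → ℝ⦄ (c : ι), c ∈ U → Adm F → E₁ (T c F) = E₁ F)
    (h₂le : ∀ ⦃F : Ω → ℝ⦄ ⦃M : ℝ⦄, Adm F → (∀ σ, F σ ≤ M) → E₂ F ≤ M)
    (h₂ge : ∀ ⦃F : Ω → ℝ⦄ ⦃M : ℝ⦄, Adm F → (∀ σ, M ≤ F σ) → M ≤ E₂ F)
    (h₂T : ∀ ⦃F : Ω → ℝ⦄ (c : ι), c ∈ U → Adm F → E₂ (T c F) = E₂ F)
    {ε : ℝ} (hε0 : 0 ≤ ε) (hε1 : ε ≤ 1) {step : (ι → ℝ) → ι → ℝ}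
    (hstep : ∀ a x, step a x = (1 - ε * U.card / Fintype.card ι) * a x +
      ε / Fintype.card ι * ∑ c ∈ U, (if x ∈ win c then ∑ y, k c y x * a y else a x))
    (m : ℕ) ⦃F : Ω → ℝ⦄ ⦃δ : ι → ℝ⦄ (hF : Adm F) (hδ : Lip F δ) :
    |E₁ F - E₂ F| ≤ ∑ x, step^[m] (fun _ => R) x * δ x := by
  induction m generalizing F δ with
  | zero => exact const_estimate hosc h₁le h₁ge h₂le h₂ge hF hδ
  | succ m ih =>
    rw [Function.iterate_succ_apply']
    exact step_estimate hlip0 hk hT hdust h₁T h₂T hε0 hε1 hstep ih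
      (iterate_step_nonneg hk hε0 hε1 hstep hR m) hF hδ

end Literature.Probability.LatticeModels.DobrushinShlosman

end
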